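import Summits.SmoothPoincare4.SmoothPoincare4.Theorems.EntropyRungNoncompactShrinkerGapHeatWeightedGreen
import Literature.Geometry.Riemannian.LinearHeatCauchyExistence
import Literature.Geometry.Lorentzian.MassCapacityHarmonic
import Literature.Geometry.Lorentzian.BlackHoles
import Literature.Analysis.FluidPDE.WeightedParametricIntegral
import HarnessLib

/-!
# Cut-off toolkit for the weighted heat flow on a complete manifold (crux
# `EntropyRung.NoncompactShrinkerGap`, stmt-SmoothPoincare4-10868, line `collapsed-ends-usc`, v13)

Auxiliary file of the helpers `helper_energyEstimate`, `helper_massConservation`,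
`helper_energyVanishing` (energy method with compactly supported cut-offs `η_k` for solutions of
`∂ₛρ = Lρ`, `L = Δ_g − g⁻¹(dV, d·)`, on a NON-compact Riemannian manifold modelled on `ℝⁿ`).
First-order bookkeeping only, in the sub-namespace `CutoffToolkit`:

* `hasDerivAt_integral_mul_of_hasCompactSupport`, `continuousOn_integral_mul_of_hasCompactSupport`
  — `d/ds ∫ F(s,x) h(x) dμ = ∫ ∂ₛF(s,x) h(x) dμ` and continuity of `s ↦ ∫ F(s,x) h(x) dμ` for a
  compactly supported continuous weight `h` (`WeightedParametricIntegral.lean`);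
* `integral_strip_eq_intervalIntegral`, `aestronglyMeasurable_strip`,
  `integrable_strip_mul_of_hasCompactSupport` — Fubini on the strip `X × (a,b)` for
  `(μ ⊗ ds)|_{X×(a,b)}` and integrability there of `F(x,s) h(x)`, `h` compactly supported;
* `sigmaFinite_riemVolume`, `isOpenPosMeasure_riemVolume` — the Riemannian measure of a second
  countable manifold is σ-finite (so Fubini on `dV ⊗ ds` is available) and charges open sets;
* `integral_cutoff_mul_weightedLaplacian` (`∫ η (Lu) e^{-V} = ∫ u (Lη) e^{-V}`) and
  `integral_sub_mul_cutoff_mul_weightedLaplacian` — the ENERGY IDENTITY with a cut-off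
  `∫ (u − c) η (Lu) e^{-V} = −∫ η |∇u|² e^{-V} + ½ ∫ (u − c)² (Lη) e^{-V}` (from the landed
  weighted Green identities `weightedGreen_left/right`; only `Lη` enters, never a separate second
  derivative of `η`);
* `tendsto_cutoff`, `weightedLaplacian_cutoff_eventually_eq_zero`,
  `dalembertian_cutoff_eventually_eq_zero` — cut-offs eventually `= 1` near every point:
  `η_k(x) → 1` and `Lη_k(x) = 0` for large `k` (locality of `Δ_g`, `d`);
* `continuousOn_deriv_time`, `hasDerivAt_time` — time derivatives of functions smooth on
  `M × O`, `O` open.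

References: J. A. Carrillo, L. Ni, Comm. Anal. Geom. 17 (2009), §4 (integrations by parts with
cut-offs on the complete soliton) [CarrilloNi2009]; D. Bakry, I. Gentil, M. Ledoux, *Analysis and
Geometry of Markov Diffusion Operators* (2014), §3.2 [BakryGentilLedoux2014].
-/

noncomputable section

set_option linter.dupNamespace false

open scoped Manifold ContDiff ENNReal NNReal Topology
open MeasureTheory Set Filter
open Literature.Geometry.Lorentzian Literature.Geometry.Riemannian

namespace Summit.SmoothPoincare4.SmoothPoincare4.Theorems.NoncompactShrinkerGapHeat.CutoffToolkit

/-! ### Parametric integrals against a compactly supported weight; the strip `X × (a, b)` -/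

section Measure

variable {X : Type*} [TopologicalSpace X] [MeasurableSpace X]

/-- **Leibniz rule against a compactly supported weight**: for `h` continuous with compact support,
`F, ∂ₛF` jointly continuous on `X × O` (`O` open), `d/ds ∫ F(s,x) h(x) dμ = ∫ ∂ₛF(s,x) h(x) dμ` at
every `s₀ ∈ O` (`WeightedParametricIntegral.hasDerivAt_integral_smul_of_continuousOn`). [folklore] -/
theorem hasDerivAt_integral_mul_of_hasCompactSupport [OpensMeasurableSpace X]
    [SecondCountableTopology X] (μ : Measure X) [IsFiniteMeasureOnCompacts μ]
    {h : X → ℝ} (hh : Continuous h) (hhs : HasCompactSupport h) {F F' : ℝ → X → ℝ} {O : Set ℝ}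
    (hO : IsOpen O) (hF : ContinuousOn (fun p : X × ℝ ↦ F p.2 p.1) (univ ×ˢ O))
    (hF' : ContinuousOn (fun p : X × ℝ ↦ F' p.2 p.1) (univ ×ˢ O))
    (hd : ∀ s ∈ O, ∀ x, HasDerivAt (F · x) (F' s x) s) {s₀ : ℝ} (hs₀ : s₀ ∈ O) :
    HasDerivAt (fun s ↦ ∫ x, F s x * h x ∂μ) (∫ x, F' s₀ x * h x ∂μ) s₀ := by
  have hsw : ∀ {G : ℝ → X → ℝ}, ContinuousOn (fun p : X × ℝ ↦ G p.2 p.1) (univ ×ˢ O) →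
      ContinuousOn (Function.uncurry G) (O ×ˢ univ) := fun {G} hG ↦ by
    have h1 : ContinuousOn (fun q : ℝ × X ↦ (q.2, q.1)) (O ×ˢ univ) :=
      (continuous_snd.prodMk continuous_fst).continuousOn
    refine (hG.comp h1 fun q hq ↦ ⟨mem_univ _, hq.1⟩).congr fun q _ ↦ ?_
    simp [Function.uncurry]
  have hmain := Literature.Analysis.FluidPDE.hasDerivAt_integral_smul_of_continuousOn (μ := μ) hh
    hhs hO (hsw hF) (hsw hF') hd hs₀
  have e1 : (fun s ↦ ∫ x, F s x * h x ∂μ) = fun s ↦ ∫ x, h x • F s x ∂μ := by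
    funext s; congr 1; funext x; rw [smul_eq_mul, mul_comm]
  have e2 : ∫ x, F' s₀ x * h x ∂μ = ∫ x, h x • F' s₀ x ∂μ := by
    congr 1; funext x; rw [smul_eq_mul, mul_comm]
  rw [e1, e2]
  exact hmain

/-- **Continuity of `s ↦ ∫ F(s,x) h(x) dμ` on `O`** for `h` continuous with compact support and
`F` jointly continuous on `X × O`. [folklore] -/
theorem continuousOn_integral_mul_of_hasCompactSupport [OpensMeasurableSpace X]
    (μ : Measure X) [IsFiniteMeasureOnCompacts μ]
    {h : X → ℝ} (hh : Continuous h) (hhs : HasCompactSupport h) {F : ℝ → X → ℝ} {O : Set ℝ}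
    (hF : ContinuousOn (fun p : X × ℝ ↦ F p.2 p.1) (univ ×ˢ O)) :
    ContinuousOn (fun s ↦ ∫ x, F s x * h x ∂μ) O := by
  have h1 : ContinuousOn (fun q : ℝ × X ↦ (q.2, q.1)) (O ×ˢ univ) :=
    (continuous_snd.prodMk continuous_fst).continuousOn
  have hsw : ContinuousOn (Function.uncurry F) (O ×ˢ univ) :=
    (hF.comp h1 fun q hq ↦ ⟨mem_univ _, hq.1⟩).congr fun q _ ↦ by simp [Function.uncurry]
  have hmain := Literature.Analysis.FluidPDE.continuousOn_integral_smul_of_continuousOn (μ := μ)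
    hh hhs hsw
  have e1 : (fun s ↦ ∫ x, F s x * h x ∂μ) = fun s ↦ ∫ x, h x • F s x ∂μ := by
    funext s; congr 1; funext x; rw [smul_eq_mul, mul_comm]
  rw [e1]
  exact hmain

omit [TopologicalSpace X] in
/-- **Fubini on the strip**: for `f` integrable on `X × (a, b)` (`μ ⊗ ds` restricted),
`∫∫_{X×(a,b)} f = ∫ₐᵇ (∫_X f(x, s) dμ) ds`. [folklore] -/
theorem integral_strip_eq_intervalIntegral (μ : Measure X) [SFinite μ] {a b : ℝ} (hab : a ≤ b)
    {f : X × ℝ → ℝ}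
    (hf : Integrable f ((μ.prod (volume : Measure ℝ)).restrict (univ ×ˢ Ioo a b))) :
    ∫ p, f p ∂(μ.prod (volume : Measure ℝ)).restrict (univ ×ˢ Ioo a b) =
      ∫ s in a..b, ∫ x, f (x, s) ∂μ := by
  have hν : (μ.prod (volume : Measure ℝ)).restrict (univ ×ˢ Ioo a b) =
      μ.prod ((volume : Measure ℝ).restrict (Ioo a b)) := by
    rw [← Measure.prod_restrict, Measure.restrict_univ]
  rw [hν] at hf ⊢
  rw [integral_prod_symm f hf, intervalIntegral.integral_of_le hab, integral_Ioc_eq_integral_Ioo]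

/-- A function continuous on the strip `X × (a, b)` is a.e. strongly measurable for
`(μ ⊗ ds)|_{X × (a,b)}`. [folklore] -/
theorem aestronglyMeasurable_strip [OpensMeasurableSpace X] [SecondCountableTopology X]
    (μ : Measure X) {a b : ℝ} {f : X × ℝ → ℝ} (hf : ContinuousOn f (univ ×ˢ Ioo a b)) :
    AEStronglyMeasurable f ((μ.prod (volume : Measure ℝ)).restrict (univ ×ˢ Ioo a b)) :=
  hf.aestronglyMeasurable (MeasurableSet.univ.prod measurableSet_Ioo)

/-- **Integrability on the strip of `F(x,s) h(x)`** for `F` continuous on `X × [a, b]` and `h`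
continuous with compact support (bounded on the compact `tsupport h × [a, b]`, zero elsewhere).
[folklore] -/
theorem integrable_strip_mul_of_hasCompactSupport [OpensMeasurableSpace X]
    [SecondCountableTopology X] (μ : Measure X) [IsFiniteMeasureOnCompacts μ] [SFinite μ]
    {a b : ℝ} {F : X × ℝ → ℝ} (hF : ContinuousOn F (univ ×ˢ Icc a b)) {h : X → ℝ}
    (hh : Continuous h) (hhs : HasCompactSupport h) :
    Integrable (fun p : X × ℝ ↦ F p * h p.1)
      ((μ.prod (volume : Measure ℝ)).restrict (univ ×ˢ Ioo a b)) := by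
  have hK : IsCompact (tsupport h ×ˢ Icc a b) := hhs.prod isCompact_Icc
  have hc : ContinuousOn (fun p : X × ℝ ↦ F p * h p.1) (tsupport h ×ˢ Icc a b) :=
    (hF.mono (prod_mono (subset_univ _) le_rfl)).mul (hh.comp continuous_fst).continuousOn
  have h1 : IntegrableOn (fun p : X × ℝ ↦ F p * h p.1) (tsupport h ×ˢ Icc a b)
      (μ.prod (volume : Measure ℝ)) :=
    hc.integrableOn_compact' hK ((isClosed_tsupport h).prod isClosed_Icc).measurableSet
  refine h1.of_forall_sdiff_eq_zero (MeasurableSet.univ.prod measurableSet_Ioo) fun p hp ↦ ?_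
  have hp1 : p.1 ∉ tsupport h := fun h' ↦ hp.2 ⟨h', Ioo_subset_Icc_self hp.1.2⟩
  simp [image_eq_zero_of_notMem_tsupport hp1]

end Measure

/-! ### The Riemannian measure of a second countable manifold; Green identities with compact
support on `g.riemVolume` -/

section Manifold

variable {n : ℕ} {M : Type*} [TopologicalSpace M] [T2Space M] [SecondCountableTopology M]
  [ChartedSpace (EuclideanSpace ℝ (Fin n)) M] [IsManifold (𝓡 n) ∞ M] [T3Space M]
  [MeasurableSpace M] [BorelSpace M]
  {g : PseudoRiemannianMetric (𝓡 n) ∞ (EuclideanSpace ℝ (Fin n)) (TangentSpace (𝓡 n) : M → Type _)}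

omit [T2Space M] in
/-- The Riemannian measure of a Riemannian metric on a second countable manifold modelled on `ℝⁿ`
is σ-finite (finite on compact sets, locally compact, second countable). [folklore] -/
theorem sigmaFinite_riemVolume (hg : g.IsRiemannian) : SigmaFinite g.riemVolume := by
  haveI : LocallyCompactSpace M := ChartedSpace.locallyCompactSpace (EuclideanSpace ℝ (Fin n)) M
  haveI := CarrilloNi2009_shrinkerLSI.isFiniteMeasureOnCompacts_riemVolume hg
  infer_instance

omit [T2Space M] [SecondCountableTopology M] in
/-- The Riemannian measure charges nonempty open sets. [folklore] -/
theorem isOpenPosMeasure_riemVolume (hg : g.IsRiemannian) : g.riemVolume.IsOpenPosMeasure := by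
  rw [PseudoRiemannianMetric.riemVolume_eq hg]
  exact isOpenPosMeasure_riemannianMeasure _

variable [g.HasLeviCivita]

/-! ### Two integrations by parts against a compactly supported cut-off -/

/-- **`∫ η (Lu) e^{-V} = ∫ u (Lη) e^{-V}`** for `u, V` smooth and `η` smooth with compact support
(both sides are `−∫ g⁻¹(dη, du) e^{-V}`). [cite: BakryGentilLedoux2014, §3.2] -/
theorem integral_cutoff_mul_weightedLaplacian (hg : g.IsRiemannian) {u η V : M → ℝ}
    (hu : ContMDiff (𝓡 n) 𝓘(ℝ, ℝ) ∞ u) (hη : ContMDiff (𝓡 n) 𝓘(ℝ, ℝ) ∞ η)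
    (hηc : HasCompactSupport η) (hV : ContMDiff (𝓡 n) 𝓘(ℝ, ℝ) ∞ V) :
    ∫ x, η x * (g.dalembertian u x - g.innerDual x (mvfderiv (𝓡 n) V x).toLinearMap
        (mvfderiv (𝓡 n) u x).toLinearMap) * Real.exp (-V x) ∂g.riemVolume =
      ∫ x, u x * (g.dalembertian η x - g.innerDual x (mvfderiv (𝓡 n) V x).toLinearMap
        (mvfderiv (𝓡 n) η x).toLinearMap) * Real.exp (-V x) ∂g.riemVolume := by
  have h2 : (2 : ℕ∞ω) ≤ (∞ : ℕ∞ω) := WithTop.coe_le_coe.mpr le_top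
  have h1 : (1 : ℕ∞ω) ≤ (∞ : ℕ∞ω) := WithTop.coe_le_coe.mpr le_top
  rw [weightedGreen_left hg (hη.of_le h1) hηc (hu.of_le h2)
      (hV.of_le h1),
    weightedGreen_right hg (hu.of_le h1) (hη.of_le h2) hηc
      (hV.of_le h1)]
  congr 1
  refine integral_congr_ae (Eventually.of_forall fun x ↦ ?_)
  beta_reduce
  rw [g.innerDual_comm]

/-- **The energy identity with a cut-off**: for `u, V` smooth, `η` smooth with compact support
and a constant `c`,
`∫ (u − c) η (Lu) e^{-V} = −∫ η |∇u|² e^{-V} + ½ ∫ (u − c)² (Lη) e^{-V}`: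
Green with the compactly supported `(u − c)η` gives `−∫ (η|du|² + (u − c) g⁻¹(dη, du)) e^{-V}`,
and `2 (u − c) g⁻¹(dη, du) = g⁻¹(dη, d(u − c)²)` is moved onto `Lη` by Green with the compactly
supported `η`. Only `Lη` — no separate second derivative of `η` — appears.
[cite: CarrilloNi2009, §4 (integration by parts on the complete soliton)] -/
theorem integral_sub_mul_cutoff_mul_weightedLaplacian (hg : g.IsRiemannian) {u η V : M → ℝ}
    (hu : ContMDiff (𝓡 n) 𝓘(ℝ, ℝ) ∞ u) (hη : ContMDiff (𝓡 n) 𝓘(ℝ, ℝ) ∞ η)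
    (hηc : HasCompactSupport η) (hV : ContMDiff (𝓡 n) 𝓘(ℝ, ℝ) ∞ V) (c : ℝ) :
    ∫ x, (u x - c) * η x * (g.dalembertian u x - g.innerDual x (mvfderiv (𝓡 n) V x).toLinearMap
        (mvfderiv (𝓡 n) u x).toLinearMap) * Real.exp (-V x) ∂g.riemVolume =
      -∫ x, η x * g.gradSq u x * Real.exp (-V x) ∂g.riemVolume
        + 1 / 2 * ∫ x, (u x - c) ^ 2 * (g.dalembertian η x
          - g.innerDual x (mvfderiv (𝓡 n) V x).toLinearMap (mvfderiv (𝓡 n) η x).toLinearMap) *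
            Real.exp (-V x) ∂g.riemVolume := by
  haveI := CarrilloNi2009_shrinkerLSI.isFiniteMeasureOnCompacts_riemVolume hg
  have h2 : (2 : ℕ∞ω) ≤ (∞ : ℕ∞ω) := WithTop.coe_le_coe.mpr le_top
  have h1 : (1 : ℕ∞ω) ≤ (∞ : ℕ∞ω) := WithTop.coe_le_coe.mpr le_top
  -- smoothness and differentiability
  have hsub : ContMDiff (𝓡 n) 𝓘(ℝ, ℝ) ∞ (fun y ↦ u y - c) := hu.sub contMDiff_const
  have ha : ContMDiff (𝓡 n) 𝓘(ℝ, ℝ) ∞ (fun y ↦ (u y - c) * η y) := hsub.mul hη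
  have hac : HasCompactSupport (fun y ↦ (u y - c) * η y) := hηc.mul_left
  have hsq : ContMDiff (𝓡 n) 𝓘(ℝ, ℝ) ∞ (fun y ↦ (u y - c) ^ 2) :=
    ((contDiff_id (𝕜 := ℝ)).pow 2).comp_contMDiff hsub
  have hud : ∀ x, MDifferentiableAt (𝓡 n) 𝓘(ℝ, ℝ) u x := fun x ↦ hu.mdifferentiableAt (by simp)
  have hηd : ∀ x, MDifferentiableAt (𝓡 n) 𝓘(ℝ, ℝ) η x := fun x ↦ hη.mdifferentiableAt (by simp)
  have hsubd : ∀ x, MDifferentiableAt (𝓡 n) 𝓘(ℝ, ℝ) (fun y ↦ u y - c) x := fun x ↦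
    hsub.mdifferentiableAt (by simp)
  have hdsub : ∀ x, mvfderiv (𝓡 n) (fun y ↦ u y - c) x = mvfderiv (𝓡 n) u x := fun x ↦ by
    rw [mvfderiv_fun_sub (hud x) mdifferentiableAt_const, mvfderiv_const, sub_zero]
  -- `d((u - c) η) = (u - c) dη + η du`, `d(u - c)² = 2 (u - c) du`
  have hda : ∀ x, (mvfderiv (𝓡 n) (fun y ↦ (u y - c) * η y) x).toLinearMap =
      (u x - c) • (mvfderiv (𝓡 n) η x).toLinearMap + η x • (mvfderiv (𝓡 n) u x).toLinearMap := by
    intro x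
    rw [mvfderiv_fun_mul (hsubd x) (hηd x), hdsub x]
    simp
  have hdsq : ∀ x, (mvfderiv (𝓡 n) (fun y ↦ (u y - c) ^ 2) x).toLinearMap =
      (2 * (u x - c)) • (mvfderiv (𝓡 n) u x).toLinearMap := by
    intro x
    ext v
    have hd1 : HasDerivAt (fun t : ℝ ↦ t ^ 2) (2 * (u x - c)) (u x - c) := by
      simpa using hasDerivAt_pow 2 (u x - c)
    have hc := mvfderiv_real_comp_apply (I := 𝓡 n) (φ := fun y ↦ u y - c) (x := x) hd1
      (hsubd x) v
    rw [hdsub x] at hc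
    simpa [Function.comp_def] using hc
  -- the two Green identities
  have hA : ∫ x, (u x - c) * η x * (g.dalembertian u x
        - g.innerDual x (mvfderiv (𝓡 n) V x).toLinearMap (mvfderiv (𝓡 n) u x).toLinearMap) *
          Real.exp (-V x) ∂g.riemVolume =
      -∫ x, g.innerDual x (mvfderiv (𝓡 n) (fun y ↦ (u y - c) * η y) x).toLinearMap
          (mvfderiv (𝓡 n) u x).toLinearMap * Real.exp (-V x) ∂g.riemVolume :=
    weightedGreen_left hg (ha.of_le h1) hac (hu.of_le h2)
      (hV.of_le h1)
  have hB : ∫ x, (u x - c) ^ 2 * (g.dalembertian η x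
        - g.innerDual x (mvfderiv (𝓡 n) V x).toLinearMap (mvfderiv (𝓡 n) η x).toLinearMap) *
          Real.exp (-V x) ∂g.riemVolume =
      -∫ x, g.innerDual x (mvfderiv (𝓡 n) (fun y ↦ (u y - c) ^ 2) x).toLinearMap
          (mvfderiv (𝓡 n) η x).toLinearMap * Real.exp (-V x) ∂g.riemVolume :=
    weightedGreen_right hg (hsq.of_le h1) (hη.of_le h2) hηc
      (hV.of_le h1)
  -- pointwise forms of the right-hand sides
  have hpA : ∀ x, g.innerDual x (mvfderiv (𝓡 n) (fun y ↦ (u y - c) * η y) x).toLinearMap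
        (mvfderiv (𝓡 n) u x).toLinearMap * Real.exp (-V x) =
      η x * g.gradSq u x * Real.exp (-V x) + (u x - c) * g.innerDual x
        (mvfderiv (𝓡 n) η x).toLinearMap (mvfderiv (𝓡 n) u x).toLinearMap * Real.exp (-V x) := by
    intro x
    rw [hda x, g.innerDual_add_left, g.innerDual_smul_left, g.innerDual_smul_left]
    simp only [PseudoRiemannianMetric.gradSq]
    ring
  have hpB : ∀ x, g.innerDual x (mvfderiv (𝓡 n) (fun y ↦ (u y - c) ^ 2) x).toLinearMap
        (mvfderiv (𝓡 n) η x).toLinearMap * Real.exp (-V x) =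
      2 * ((u x - c) * g.innerDual x (mvfderiv (𝓡 n) η x).toLinearMap
        (mvfderiv (𝓡 n) u x).toLinearMap * Real.exp (-V x)) := by
    intro x
    rw [hdsq x, g.innerDual_smul_left, g.innerDual_comm]
    ring
  -- integrability of the two pieces (compact support)
  have hec : Continuous fun x ↦ Real.exp (-V x) := Real.continuous_exp.comp hV.continuous.neg
  have hIc := continuous_innerDual_mvfderiv g (hη.of_le h1) (hu.of_le h1)
  have iG : Integrable (fun x ↦ η x * g.gradSq u x * Real.exp (-V x)) g.riemVolume :=
    ((hη.continuous.mul (contMDiff_gradSq g hu).continuous).mul hec).integrable_of_hasCompactSupport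
      (hηc.mul_right.mul_right)
  have iX : Integrable (fun x ↦ (u x - c) * g.innerDual x (mvfderiv (𝓡 n) η x).toLinearMap
      (mvfderiv (𝓡 n) u x).toLinearMap * Real.exp (-V x)) g.riemVolume := by
    have hs : HasCompactSupport (fun x ↦ (u x - c) * g.innerDual x
        (mvfderiv (𝓡 n) η x).toLinearMap (mvfderiv (𝓡 n) u x).toLinearMap * Real.exp (-V x)) := by
      refine HasCompactSupport.intro hηc fun x hx ↦ ?_
      rw [innerDual_mvfderiv_eq_zero_of_notMem_tsupport_left hx, mul_zero, zero_mul]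
    exact ((hsub.continuous.mul hIc).mul hec).integrable_of_hasCompactSupport hs
  rw [hA, hB, integral_congr_ae (Eventually.of_forall hpA), integral_add iG iX,
    integral_congr_ae (Eventually.of_forall hpB), integral_const_mul]
  ring

/-! ### Cut-offs eventually equal to one near every point -/

omit [T2Space M] [SecondCountableTopology M] [ChartedSpace (EuclideanSpace ℝ (Fin n)) M]
  [IsManifold (𝓡 n) ∞ M] [T3Space M] [MeasurableSpace M] [BorelSpace M] [g.HasLeviCivita] in
/-- A cut-off sequence eventually `= 1` near `x` converges to `1` at `x`. [folklore] -/
theorem tendsto_cutoff {η : ℕ → M → ℝ} (hη1 : ∀ x, ∀ᶠ k in atTop, ∀ᶠ y in 𝓝 x, η k y = 1)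
    (x : M) : Tendsto (fun k ↦ η k x) atTop (𝓝 1) :=
  tendsto_const_nhds.congr' (by
    filter_upwards [hη1 x] with k hk
    exact (hk.self_of_nhds).symm)

omit [T2Space M] [SecondCountableTopology M] [T3Space M] [MeasurableSpace M] [BorelSpace M] in
/-- For a cut-off sequence eventually `= 1` near `x`, `Lη_k(x) = Δη_k(x) − g⁻¹(dV, dη_k)(x) = 0`
for all large `k` (locality of `Δ_g` and of `d`). [folklore] -/
theorem weightedLaplacian_cutoff_eventually_eq_zero {V : M → ℝ} {η : ℕ → M → ℝ}
    (hη1 : ∀ x, ∀ᶠ k in atTop, ∀ᶠ y in 𝓝 x, η k y = 1) (x : M) :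
    ∀ᶠ k in atTop, g.dalembertian (η k) x - g.innerDual x (mvfderiv (𝓡 n) V x).toLinearMap
      (mvfderiv (𝓡 n) (η k) x).toLinearMap = 0 := by
  haveI : Fact ((1 : ℕ∞ω) ≤ (∞ : ℕ∞ω)) := ⟨WithTop.coe_le_coe.2 le_top⟩
  filter_upwards [hη1 x] with k hk
  have hk' : η k =ᶠ[𝓝 x] fun _ ↦ (1 : ℝ) := hk
  rw [g.dalembertian_congr_of_eventuallyEq hk', g.dalembertian_const, mvfderiv_congr_of_eventuallyEq
    hk', mvfderiv_const, ContinuousLinearMap.toLinearMap_zero, g.innerDual_comm]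
  simp [PseudoRiemannianMetric.innerDual]

omit [T2Space M] [SecondCountableTopology M] [T3Space M] [MeasurableSpace M] [BorelSpace M] in
/-- For a cut-off sequence eventually `= 1` near `x`, `Δη_k(x) = 0` for all large `k`.
[folklore] -/
theorem dalembertian_cutoff_eventually_eq_zero {η : ℕ → M → ℝ}
    (hη1 : ∀ x, ∀ᶠ k in atTop, ∀ᶠ y in 𝓝 x, η k y = 1) (x : M) :
    ∀ᶠ k in atTop, g.dalembertian (η k) x = 0 := by
  haveI : Fact ((1 : ℕ∞ω) ≤ (∞ : ℕ∞ω)) := ⟨WithTop.coe_le_coe.2 le_top⟩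
  filter_upwards [hη1 x] with k hk
  have hk' : η k =ᶠ[𝓝 x] fun _ ↦ (1 : ℝ) := hk
  rw [g.dalembertian_congr_of_eventuallyEq hk', g.dalembertian_const]

/-! ### Time derivatives of functions smooth on `M × O`, `O` open -/

omit [T2Space M] [SecondCountableTopology M] [T3Space M] [MeasurableSpace M] [BorelSpace M]
  [g.HasLeviCivita] in
/-- For `ρ` smooth on `M × O` (`O` open), `(x, s) ↦ ∂ₛρ(s, x)` is continuous on `M × O`
(`contMDiffOn_derivWithin_time_of_uniqueDiffOn`, `derivWithin = deriv` on the open `O`).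
[folklore] -/
theorem continuousOn_deriv_time {O : Set ℝ} (hO : IsOpen O) {ρ : ℝ → M → ℝ}
    (hρ : ContMDiffOn ((𝓡 n).prod 𝓘(ℝ, ℝ)) 𝓘(ℝ, ℝ) ∞ (fun p : M × ℝ ↦ ρ p.2 p.1) (univ ×ˢ O)) :
    ContinuousOn (fun p : M × ℝ ↦ deriv (fun r ↦ ρ r p.1) p.2) (univ ×ˢ O) := by
  have h := (contMDiffOn_derivWithin_time_of_uniqueDiffOn hO.uniqueDiffOn hρ).continuousOn
  refine h.congr fun p hp ↦ ?_
  exact (derivWithin_of_isOpen hO hp.2).symm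

omit [T2Space M] [SecondCountableTopology M] [IsManifold (𝓡 n) ∞ M] [T3Space M]
  [MeasurableSpace M] [BorelSpace M] [g.HasLeviCivita] in
/-- For `ρ` smooth on `M × O` (`O` open), `s ↦ ρ(s, x)` has derivative `deriv (ρ · x) s` at
`s ∈ O`. [folklore] -/
theorem hasDerivAt_time {O : Set ℝ} (hO : IsOpen O) {ρ : ℝ → M → ℝ}
    (hρ : ContMDiffOn ((𝓡 n).prod 𝓘(ℝ, ℝ)) 𝓘(ℝ, ℝ) ∞ (fun p : M × ℝ ↦ ρ p.2 p.1) (univ ×ˢ O))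
    (x : M) {s : ℝ} (hs : s ∈ O) :
    HasDerivAt (fun r ↦ ρ r x) (deriv (fun r ↦ ρ r x) s) s :=
  hasDerivAt_slice_of_contMDiffOn hO (v := fun p : M × ℝ ↦ ρ p.2 p.1) hρ x hs

end Manifold

end Summit.SmoothPoincare4.SmoothPoincare4.Theorems.NoncompactShrinkerGapHeat.CutoffToolkit

namespace Summit.SmoothPoincare4.SmoothPoincare4.Theorems.NoncompactShrinkerGapHeat

/-- **The energy identity with a cut-off** (registered form `helper_cutoffEnergyIdentity` of
`CutoffToolkit.integral_sub_mul_cutoff_mul_weightedLaplacian`): for `u, V` smooth, `η ∈ C_c^∞` and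
a constant `c`, `∫ (u − c) η (Lu) e^{-V} = −∫ η |∇u|² e^{-V} + ½ ∫ (u − c)² (Lη) e^{-V}`,
`L = Δ_g − g⁻¹(dV, d·)`. [cite: CarrilloNi2009, §4 (integration by parts on the complete soliton)] -/
theorem helper_cutoffEnergyIdentity : ∀ (n : ℕ) (M : Type*) [TopologicalSpace M] [T2Space M] [SecondCountableTopology M] [ChartedSpace (EuclideanSpace ℝ (Fin n)) M] [IsManifold (𝓡 n) ∞ M] [T3Space M] [MeasurableSpace M] [BorelSpace M] (g : PseudoRiemannianMetric (𝓡 n) ∞ (EuclideanSpace ℝ (Fin n)) (TangentSpace (𝓡 n) : M → Type _)) [g.HasLeviCivita] (V : M → ℝ), g.IsRiemannian → ContMDiff (𝓡 n) 𝓘(ℝ, ℝ) ∞ V → ∀ (u η : M → ℝ) (c : ℝ), ContMDiff (𝓡 n) 𝓘(ℝ, ℝ) ∞ u → ContMDiff (𝓡 n) 𝓘(ℝ, ℝ) ∞ η → HasCompactSupport η → ∫ x, (u x - c) * η x * (g.dalembertian u x - g.innerDual x (mvfderiv (𝓡 n) V x).toLinearMap (mvfderiv (𝓡 n) u x).toLinearMap)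 * Real.exp (-V x) ∂g.riemVolume = -∫ x, η x * g.gradSq u x * Real.exp (-V x) ∂g.riemVolume + 1 / 2 * ∫ x, (u x - c) ^ 2 * (g.dalembertian η x - g.innerDual x (mvfderiv (𝓡 n) V x).toLinearMap (mvfderiv (𝓡 n) η x).toLinearMap) * Real.exp (-V x) ∂g.riemVolume :=
  fun _n _M _ _ _ _ _ _ _ _ _g _ _V hg hV _u _η c hu hη hηc ↦
    CutoffToolkit.integral_sub_mul_cutoff_mul_weightedLaplacian hg hu hη hηc hV c

end Summit.SmoothPoincare4.SmoothPoincare4.Theorems.NoncompactShrinkerGapHeat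

end
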